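import Summits.NavierStokesRegularity.NavierStokesRegularity.Theses.TypeIIInviscidRelaxation
import Summits.NavierStokesRegularity.NavierStokesRegularity.Theorems.TypeIIInviscidRelaxationAxisymSwirlRegularInflowCriticalFloor
import HarnessLib

/-!
# Line `supercritical_defect_floor` for crux `AprioriRadialInflowBound` (stmt-NavierStokesRegularity-19060)

LINE-FIRST SKELETON (linewriter-ns-typeiiinviscid-1, g0).  The crux: in the standing axisymmetric class (classical
on `[0,T)`, Leray–Hopf, bounded on sub-slabs, axisymmetric slices, rapidly decaying datum) the radial momentum
`Φ = x₀u₀ + x₁u₁ = r u_r` is a priori `≥ -Cν` on an axis tube (bounded inflow Reynolds number).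

IDEA (minimum principle, floor asked only in the SUPERCRITICAL-INFLOW regime).  `Φ` obeys the parabolic equation
`(∂_t + b·∇ - ν(Δ - (2/r)∂_r))Φ = u_r² + u_θ² - r∂_r p` (tree: `…RadialMomentumCalculus`), so a weak minimum principle
bounds `min Φ` from below by the data minus the time integral of the negative part of the CYCLOSTROPHIC DEFECT
`u_r² + u_θ² - r∂_r p` at the running interior minimiser (tree engines: `radialMomentumMinPrinciple` = S2 of the birth
skeleton, whole-tube floor; `inflowBound_of_criticalDefectFloor`, floor at off-axis critical points of `Φ` with `ΔΦ ≥ 0`).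
The first-touching-point form of that argument evaluates the defect ONLY where `Φ` is already below the barrier level,
i.e. in the supercritical sub-level set `{Φ ≤ -C₀ν}`.  So the crux splits into
* `stub_minPrinciple_sublevel` [assembly/print, M]: the engine with the floor asked only at off-axis critical points of
  `Φ(t,·)` with `ΔΦ ≥ 0` AND `Φ ≤ -C₀ν` (any real `C₀`) — a re-run of the tree engine's proof by first touching point;
* `stub_supercriticalDefectFloor` [research, L]: in the standing class there are `C₀, δ > 0` and a continuous
  `g ∈ L¹[0,T)` flooring the defect at exactly those points: "where the inflow Reynolds number `r|u_r|/ν` is ≥ C₀ and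
  locally strongest, the inward pressure pull `r∂_r p` exceeds the centrifugal supply `u_θ² + u_r²` by at most `g(t)`".
This is weaker than S1 (whole tube) and than the tree's critical-point floor (all levels): the open content is confined
to the regime a Hou-type focusing jet must inhabit (`Φ ≪ -ν`), where inflow advects the swirl `Γ` inward and raises the
centrifugal term — the only mechanism on offer for a floor.

Composition `AprioriRadialInflowBound_of` is sorry-free outside the two stubs.
-/

noncomputable section

open Literature.Analysis.FluidPDE MeasureTheory Set Function Filter Topology Metric WithLp
open scoped InnerProductSpace RealInnerProductSpace Laplacian ContDiff

namespace Summit.NavierStokesRegularity.NavierStokesRegularity.Cruxes.AprioriRadialInflowBound.SupercriticalDefectFloor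

set_option linter.dupNamespace false

open Summit.NavierStokesRegularity.NavierStokesRegularity.Theorems

/-- **stub_minPrinciple_sublevel** [assembly / print-grade, M].  The radial-momentum minimum principle with the defect
floor asked only on the supercritical sub-level set: in the standing class, if for some real `C₀`, some `δ > 0` and a
continuous integrable `g ≥ ?` on `[0,T)` the cyclostrophic defect is `≥ -g(t)` at every off-axis point of the tube
`{cylRadius < δ}` that is a spatial critical point of `Φ(t,·) = x₀u₀ + x₁u₁` with `ΔΦ(t,x) ≥ 0` and `Φ(t,x) ≤ -C₀ν`,
then `Φ ≥ -Cν` on a thinner tube for all `t ∈ [0,T)`.  Proof plan: the tree engine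
`radialMomentum_minPrinciple_engine_critical` (truncation at `|x| ≤ R` by the far-field / off-tube / sub-slab bounds,
barrier `-K - ∫₀ᵗ g⁺ - ε(1+t)` with `K ≥ max(C₀ν, δM/2)`): at the first touching time the touching point is an interior
off-axis spatial minimum of `Φ(t,·)`, hence critical with `ΔΦ ≥ 0`, and there `Φ = ` barrier `≤ -K ≤ -C₀ν`, so the
restricted floor suffices.  [adapts tree: `…InflowCriticalFloor`, `…InflowMinPrinciple`] -/
theorem stub_minPrinciple_sublevel {ν T : ℝ} (hν : 0 < ν) (hT : 0 < T)
    {u : ℝ → EuclideanSpace ℝ (Fin 3) → EuclideanSpace ℝ (Fin 3)} {p : ℝ → EuclideanSpace ℝ (Fin 3) → ℝ}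
    (hcl : IsClassicalNSSolutionOn (Ico 0 T) ν 0 u p) (hLH : IsLerayHopfOn T ν 0 (u 0) u)
    (hbd : ∀ T' < T, ∃ M : ℝ, ∀ t ∈ Icc 0 T', ∀ x, ‖u t x‖ ≤ M)
    (hax : ∀ t ∈ Ico 0 T, IsAxisymmetric (u t)) (hdec : HasRapidSpatialDecay (u 0))
    {C₀ δ : ℝ} (hδ : 0 < δ) {g : ℝ → ℝ} (hgc : ContinuousOn g (Ico 0 T)) (hgi : IntegrableOn g (Ico 0 T))
    (hfl : ∀ t ∈ Ico 0 T, ∀ x : EuclideanSpace ℝ (Fin 3), cylRadius x < δ → cylRadius x ≠ 0 →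
      x 0 * u t x 0 + x 1 * u t x 1 ≤ -(C₀ * ν) →
      fderiv ℝ (fun z : EuclideanSpace ℝ (Fin 3) => z 0 * u t z 0 + z 1 * u t z 1) x = 0 →
      0 ≤ (Δ (fun z : EuclideanSpace ℝ (Fin 3) => z 0 * u t z 0 + z 1 * u t z 1)) x →
      -g t ≤ (u t x 0) ^ 2 + (u t x 1) ^ 2
        - (x 0 * fderiv ℝ (p t) x (EuclideanSpace.single 0 1)
            + x 1 * fderiv ℝ (p t) x (EuclideanSpace.single 1 1))) :
    ∃ C δ' : ℝ, 0 < δ' ∧ ∀ t ∈ Ico 0 T, ∀ x : EuclideanSpace ℝ (Fin 3), cylRadius x < δ' →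
      -(C * ν) ≤ x 0 * u t x 0 + x 1 * u t x 1 := by
  sorry

/-- **stub_supercriticalDefectFloor** [research, L — the content].  In the standing class there are a threshold `C₀`,
a tube radius `δ > 0` and a continuous `g`, integrable on `[0,T)`, such that at every time `t ∈ [0,T)` and every
off-axis point `x` with `cylRadius x < δ` where `Φ(t,·) = x₀u₀ + x₁u₁` has a spatial critical point with `ΔΦ ≥ 0` and
SUPERCRITICAL value `Φ(t,x) ≤ -C₀ν` (the instantaneous strongest-inflow points, inflow Reynolds number `≥ C₀`), the
cyclostrophic defect obeys `u₀² + u₁² - (x₀∂₀p + x₁∂₁p) ≥ -g(t)`.  Why it might fail: it is a one-sided a-priori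
PRESSURE statement beyond the energy class (EnergySupercriticality); Hou's interior scenario (arXiv:2107.06509,
arXiv:2405.10916) is a pressure-driven focusing jet — on it `-defect` at the jet tip would have to be non-integrable in
time.  Mechanism on offer: at a supercritical strongest-inflow point `∂_z u_z = 0` (criticality + incompressibility) and
the inflow has been advecting `Γ = r u_θ` inward (`|Γ| ≤ ‖Γ₀‖_∞`), which feeds the centrifugal term.  Sources:
Hou2022PotentiallySingularNS; KochNadirashviliSereginSverak2009; LeiZhang2017; ChaeLee2002 (sign criteria). -/
theorem stub_supercriticalDefectFloor {ν T : ℝ} (hν : 0 < ν) (hT : 0 < T)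
    {u : ℝ → EuclideanSpace ℝ (Fin 3) → EuclideanSpace ℝ (Fin 3)} {p : ℝ → EuclideanSpace ℝ (Fin 3) → ℝ}
    (hcl : IsClassicalNSSolutionOn (Ico 0 T) ν 0 u p) (hLH : IsLerayHopfOn T ν 0 (u 0) u)
    (hbd : ∀ T' < T, ∃ M : ℝ, ∀ t ∈ Icc 0 T', ∀ x, ‖u t x‖ ≤ M)
    (hax : ∀ t ∈ Ico 0 T, IsAxisymmetric (u t)) (hdec : HasRapidSpatialDecay (u 0)) :
    ∃ (C₀ δ : ℝ) (g : ℝ → ℝ), 0 < δ ∧ ContinuousOn g (Ico 0 T) ∧ IntegrableOn g (Ico 0 T) ∧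
      ∀ t ∈ Ico 0 T, ∀ x : EuclideanSpace ℝ (Fin 3), cylRadius x < δ → cylRadius x ≠ 0 →
        x 0 * u t x 0 + x 1 * u t x 1 ≤ -(C₀ * ν) →
        fderiv ℝ (fun z : EuclideanSpace ℝ (Fin 3) => z 0 * u t z 0 + z 1 * u t z 1) x = 0 →
        0 ≤ (Δ (fun z : EuclideanSpace ℝ (Fin 3) => z 0 * u t z 0 + z 1 * u t z 1)) x →
        -g t ≤ (u t x 0) ^ 2 + (u t x 1) ^ 2
          - (x 0 * fderiv ℝ (p t) x (EuclideanSpace.single 0 1)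
              + x 1 * fderiv ℝ (p t) x (EuclideanSpace.single 1 1)) := by
  sorry

/-- PROVED sanity link: the tree's all-levels critical-point floor (hypothesis of
`inflowBound_of_criticalDefectFloor`) is the special case "every level" of the supercritical floor, so the research
stub is WEAKER than what the tree already cashes. -/
theorem supercriticalFloor_of_criticalFloor {ν T : ℝ}
    {u : ℝ → EuclideanSpace ℝ (Fin 3) → EuclideanSpace ℝ (Fin 3)} {p : ℝ → EuclideanSpace ℝ (Fin 3) → ℝ}
    {δ : ℝ} {g : ℝ → ℝ} (C₀ : ℝ)
    (hfl : ∀ t ∈ Ico 0 T, ∀ x : EuclideanSpace ℝ (Fin 3), cylRadius x < δ → cylRadius x ≠ 0 →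
      fderiv ℝ (fun z : EuclideanSpace ℝ (Fin 3) => z 0 * u t z 0 + z 1 * u t z 1) x = 0 →
      0 ≤ (Δ (fun z : EuclideanSpace ℝ (Fin 3) => z 0 * u t z 0 + z 1 * u t z 1)) x →
      -g t ≤ (u t x 0) ^ 2 + (u t x 1) ^ 2
        - (x 0 * fderiv ℝ (p t) x (EuclideanSpace.single 0 1)
            + x 1 * fderiv ℝ (p t) x (EuclideanSpace.single 1 1))) :
    ∀ t ∈ Ico 0 T, ∀ x : EuclideanSpace ℝ (Fin 3), cylRadius x < δ → cylRadius x ≠ 0 →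
      x 0 * u t x 0 + x 1 * u t x 1 ≤ -(C₀ * ν) →
      fderiv ℝ (fun z : EuclideanSpace ℝ (Fin 3) => z 0 * u t z 0 + z 1 * u t z 1) x = 0 →
      0 ≤ (Δ (fun z : EuclideanSpace ℝ (Fin 3) => z 0 * u t z 0 + z 1 * u t z 1)) x →
      -g t ≤ (u t x 0) ^ 2 + (u t x 1) ^ 2
        - (x 0 * fderiv ℝ (p t) x (EuclideanSpace.single 0 1)
            + x 1 * fderiv ℝ (p t) x (EuclideanSpace.single 1 1)) :=
  fun t ht x hr h0 _ hcrit hlap => hfl t ht x hr h0 hcrit hlap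

/-- PROVED: with every level floored, the tree engine closes the crux's conclusion (so `stub_minPrinciple_sublevel` at
"all levels" is a theorem: `inflowBound_of_criticalDefectFloor`). -/
theorem inflowBound_of_criticalFloor_allLevels {ν T : ℝ} (hν : 0 < ν) (hT : 0 < T)
    {u : ℝ → EuclideanSpace ℝ (Fin 3) → EuclideanSpace ℝ (Fin 3)} {p : ℝ → EuclideanSpace ℝ (Fin 3) → ℝ}
    (hcl : IsClassicalNSSolutionOn (Ico 0 T) ν 0 u p) (hLH : IsLerayHopfOn T ν 0 (u 0) u)
    (hbd : ∀ T' < T, ∃ M : ℝ, ∀ t ∈ Icc 0 T', ∀ x, ‖u t x‖ ≤ M)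
    (hax : ∀ t ∈ Ico 0 T, IsAxisymmetric (u t))
    {δ : ℝ} (hδ : 0 < δ) {g : ℝ → ℝ} (hgc : ContinuousOn g (Ico 0 T)) (hgi : IntegrableOn g (Ico 0 T))
    (hfl : ∀ t ∈ Ico 0 T, ∀ x : EuclideanSpace ℝ (Fin 3), cylRadius x < δ → cylRadius x ≠ 0 →
      fderiv ℝ (fun z : EuclideanSpace ℝ (Fin 3) => z 0 * u t z 0 + z 1 * u t z 1) x = 0 →
      0 ≤ (Δ (fun z : EuclideanSpace ℝ (Fin 3) => z 0 * u t z 0 + z 1 * u t z 1)) x →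
      -g t ≤ (u t x 0) ^ 2 + (u t x 1) ^ 2
        - (x 0 * fderiv ℝ (p t) x (EuclideanSpace.single 0 1)
            + x 1 * fderiv ℝ (p t) x (EuclideanSpace.single 1 1))) :
    ∃ C δ' : ℝ, 0 < δ' ∧ ∀ t ∈ Ico 0 T, ∀ x : EuclideanSpace ℝ (Fin 3), cylRadius x < δ' →
      -(C * ν) ≤ x 0 * u t x 0 + x 1 * u t x 1 :=
  inflowBound_of_criticalDefectFloor (⟨hν, hT, hcl, hLH, hbd, hax⟩ : AxisymmetricL3Hyp ν T u p) hδ hgc hgi hfl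

/-- **Composition (sorry-free outside the stubs): the line closes the crux BY NAME.** -/
theorem AprioriRadialInflowBound_of :
    Summit.NavierStokesRegularity.NavierStokesRegularity.Theses.TypeIIInviscidRelaxation.AprioriRadialInflowBound := by
  intro ν T hν hT u p hcl hLH hbd hax hdec
  obtain ⟨C₀, δ, g, hδ, hgc, hgi, hfl⟩ := stub_supercriticalDefectFloor hν hT hcl hLH hbd hax hdec
  exact stub_minPrinciple_sublevel hν hT hcl hLH hbd hax hdec hδ hgc hgi hfl

end Summit.NavierStokesRegularity.NavierStokesRegularity.Cruxes.AprioriRadialInflowBound.SupercriticalDefectFloor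

end
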